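import Summits.NavierStokesRegularity.NavierStokesRegularity.Theses.AxisymmetricExtremality
import Summits.NavierStokesRegularity.NavierStokesRegularity.Theorems.AxisymmetricExtremalityAxisymmetricKatoGlobalNoSwirlStratum

/-!
# Strategist census s19-g6 — checked exhibits for the crux `AxisymmetricKatoGlobal`
(item stmt-NavierStokesRegularity-15453, route-NavierStokesRegularity-AxisymmetricExtremality)

Signatures referred to by `STRATEGY-CENSUS-s19-g6.md` (second independent census, family `s`).
No `sorry`; nothing here is a crux claim or a registered stub.

* `W0` — the THRESHOLD INSTANCE of the crux, the only thing `closes` consumes: no axisymmetric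
  Rusin–Šverák minimal blow-up datum.  `closes_of_W0` = the route's deciding theorem with `W0`
  in place of the crux (pure logic); `W0_of_crux`; `W0_iff_sphere` (W0 is literally the crux
  restricted to the sphere `‖g‖ₑ = ρ_max^pure ν` of data WITHOUT a global Kato solution … i.e.
  the crux restricted to the threshold sphere).
* `D2` — the swirl split: `CruxNoSwirl` is a THEOREM in tree
  (`axisymmetricKatoGlobal_noSwirl_stratum`), `CruxSwirl` the complementary stratum, the assembly
  `crux_of_swirlSplit` is proved, and `cruxSwirl_iff_crux` shows the open piece is the crux again
  over the tree (so the split fails the "no piece ↔ X" test).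
* `D1` — the data-class split `CruxSchwartz ∧ (CruxSchwartz → crux)`: assembly = modus ponens;
  recorded only to name the bridge piece.
-/

namespace Summit.NavierStokesRegularity.NavierStokesRegularity.Cruxes.AxisymmetricKatoGlobal.StrategistS19g6

open MeasureTheory Set Function
open Literature.Analysis.FluidPDE Literature.Analysis.FunctionSpaces
open Summit.NavierStokesRegularity.NavierStokesRegularity.Theses.AxisymmetricExtremality

local notation "ℝ³" => EuclideanSpace ℝ (Fin 3)
local notation "ℂ³" => EuclideanSpace ℂ (Fin 3)

/-- Axisymmetry about the `x 2`-axis written out exactly as in the route file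
(`IsAxisymmetric u₀` unfolded). -/
def AxisymUnfolded (u₀ : ℝ³ → ℝ³) : Prop :=
  ∀ (θ : ℝ) (x : ℝ³), u₀ (WithLp.toLp 2 ![Real.cos θ * x 0 - Real.sin θ * x 1,
    Real.sin θ * x 0 + Real.cos θ * x 1, x 2]) = WithLp.toLp 2 ![Real.cos θ * u₀ x 0 -
    Real.sin θ * u₀ x 1, Real.sin θ * u₀ x 0 + Real.cos θ * u₀ x 1, u₀ x 2]

theorem axisymUnfolded_iff (u₀ : ℝ³ → ℝ³) : AxisymUnfolded u₀ ↔ IsAxisymmetric u₀ := Iff.rfl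

/-! ## (1) The strictly-weaker intermediate actually consumed by `closes` -/

/-- `W0`: for every `ν > 0` there is NO axisymmetric `Ḣ^{1/2}`-minimal blow-up datum
(Rusin–Šverák's set `M(ν)` contains no axisymmetric field). -/
def W0 : Prop :=
  ∀ ν : ℝ, 0 < ν → ∀ (u₀ : ℝ³ → ℝ³) (g : HomSobolev ℝ³ ℂ³ (1 / 2 : ℝ)),
    IsMinimalBlowupDatum ν u₀ g → AxisymUnfolded u₀ → False

/-- The crux restricted to the threshold sphere `‖g‖ₑ = ρ_max^pure(ν)`. -/
def CruxOnSphere : Prop :=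
  ∀ ν : ℝ, 0 < ν → ∀ (u₀ : ℝ³ → ℝ³) (g : HomSobolev ℝ³ ℂ³ (1 / 2 : ℝ)),
    MemLp u₀ 3 volume → g.Represents (EuclideanSpace.complexify ∘ u₀) → IsWeaklyDivFree u₀ →
    AxisymUnfolded u₀ → ‖g‖ₑ = rusinSverakRhoMaxPure ν → HasGlobalKatoSolution ν u₀

theorem W0_iff_sphere : W0 ↔ CruxOnSphere := by
  constructor
  · intro h ν hν u₀ g hL3 hrep hdiv hax hnorm
    by_contra hno
    exact h ν hν u₀ g ⟨hL3, hrep, hdiv, hnorm, hno⟩ hax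
  · intro h ν hν u₀ g hmin hax
    obtain ⟨hL3, hrep, hdiv, hnorm, hno⟩ := hmin
    exact hno (h ν hν u₀ g hL3 hrep hdiv hax hnorm)

/-- crux ⇒ W0 (drop the norm hypothesis). -/
theorem W0_of_crux (h₃ : AxisymmetricKatoGlobal) : W0 := by
  intro ν hν u₁ g hmin hax
  obtain ⟨hL3, hrep, hdiv₁, -, hnot⟩ := hmin
  exact hnot (h₃ ν hν u₁ g hL3 hrep hdiv₁ hax)

/-- The route's deciding theorem goes through VERBATIM with `W0` in place of the crux:
`closes` uses the crux only on an axisymmetric minimal blow-up datum. -/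
theorem closes_of_W0 (h₂ : MinimalDatumPFold) (h₄ : PFoldToAxisymmetric) (hW : W0) :
    NavierStokesRegularity := by
  show Literature.NS.NavierStokesExistenceSmoothR3
  intro ν hν u₀ hsm hdiv hdec
  by_contra hno
  obtain ⟨u₁, g, hmin, hax⟩ := h₄ ν hν (h₂ ν hν ⟨u₀, hsm, hdiv, hdec, hno⟩)
  exact hW ν hν u₁ g hmin hax

/-! ## (2) Decompositions -/

/-- D2, piece 1 (a THEOREM): the swirl-free stratum of the crux. -/
def CruxNoSwirl : Prop :=
  ∀ ν : ℝ, 0 < ν → ∀ (u₀ : ℝ³ → ℝ³) (g : HomSobolev ℝ³ ℂ³ (1 / 2 : ℝ)),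
    MemLp u₀ 3 volume → g.Represents (EuclideanSpace.complexify ∘ u₀) → IsWeaklyDivFree u₀ →
    AxisymUnfolded u₀ → HasNoSwirl u₀ → HasGlobalKatoSolution ν u₀

/-- D2, piece 2 (open): the stratum with swirl somewhere. -/
def CruxSwirl : Prop :=
  ∀ ν : ℝ, 0 < ν → ∀ (u₀ : ℝ³ → ℝ³) (g : HomSobolev ℝ³ ℂ³ (1 / 2 : ℝ)),
    MemLp u₀ 3 volume → g.Represents (EuclideanSpace.complexify ∘ u₀) → IsWeaklyDivFree u₀ →
    AxisymUnfolded u₀ → ¬ HasNoSwirl u₀ → HasGlobalKatoSolution ν u₀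

/-- Piece 1 is in tree (Ladyzhenskaya / Ukhovskii–Yudovich in Kato's critical class, every ν). -/
theorem cruxNoSwirl_holds : CruxNoSwirl :=
  fun ν hν u₀ _g hL3 _hrep hdiv hax hsw =>
    Theorems.AxisymmetricKatoGlobal.NoSwirlStratum.axisymmetricKatoGlobal_noSwirl_stratum
      ν hν u₀ hL3 hdiv (fun θ x => hax θ x) hsw

/-- D2 assembly (proved): the two strata give the crux. -/
theorem crux_of_swirlSplit (h₁ : CruxNoSwirl) (h₂ : CruxSwirl) : AxisymmetricKatoGlobal := by
  intro ν hν u₀ g hL3 hrep hdiv hax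
  by_cases hsw : HasNoSwirl u₀
  · exact h₁ ν hν u₀ g hL3 hrep hdiv hax hsw
  · exact h₂ ν hν u₀ g hL3 hrep hdiv hax hsw

/-- … but the open piece is the crux again over the tree: D2 fails "no piece ↔ X". -/
theorem cruxSwirl_iff_crux : CruxSwirl ↔ AxisymmetricKatoGlobal :=
  ⟨fun h₂ => crux_of_swirlSplit cruxNoSwirl_holds h₂,
    fun h ν hν u₀ g hL3 hrep hdiv hax _ => h ν hν u₀ g hL3 hrep hdiv hax⟩

/-- D1, piece 1: the crux for smooth rapidly decaying (Clay-class) axisymmetric data only. -/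
def CruxSchwartz : Prop :=
  ∀ ν : ℝ, 0 < ν → ∀ (u₀ : ℝ³ → ℝ³), ContDiff ℝ (⊤ : ℕ∞) u₀ → NSWave0.IsDivFree u₀ →
    HasRapidSpatialDecay u₀ → AxisymUnfolded u₀ → HasGlobalKatoSolution ν u₀

/-- D1, piece 2 (the bridge): Clay-class axisymmetric regularity ⇒ critical-class axisymmetric
regularity.  Not routine: the blow-up set is closed, not open, in `Ḣ^{1/2}` (stability runs the
wrong way), see the census. -/
def SchwartzToCritical : Prop := CruxSchwartz → AxisymmetricKatoGlobal

/-- D1 assembly = modus ponens (a bridge split; its content is entirely in the two pieces). -/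
theorem crux_of_dataClassSplit (h₁ : CruxSchwartz) (h₂ : SchwartzToCritical) :
    AxisymmetricKatoGlobal := h₂ h₁

/-- The crux trivially gives the Clay-class piece… is NOT available either: a Clay datum is
critical (`ClayDatumCritical`, proved in tree), so crux ⇒ CruxSchwartz. -/
theorem cruxSchwartz_of_crux (hc : ClayDatumCritical) (h : AxisymmetricKatoGlobal) :
    CruxSchwartz := by
  intro ν hν u₀ hsm hdiv hdec hax
  obtain ⟨hL3, hwdiv, g, hrep⟩ := hc u₀ hsm hdiv hdec
  exact h ν hν u₀ g hL3 hrep hwdiv hax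

end Summit.NavierStokesRegularity.NavierStokesRegularity.Cruxes.AxisymmetricKatoGlobal.StrategistS19g6
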